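import Literature.NumberTheory.Sieve.FriedlanderIwaniecPrimesGaussianParam
import Literature.NumberTheory.Sieve.FriedlanderIwaniecPrimesBilinearForm
import Literature.NumberTheory.QuadraticFields.GaussianPrimary
import HarnessLib

/-!
# Friedlander–Iwaniec, *The polynomial `X² + Y⁴` captures its primes*, §5: `B*(M, N)` as a Gaussian bilinear form (5.6)

Family `parity`, statement parity.S17 (`setOf_prime_sq_add_pow_four_infinite`). Source: J. Friedlander,
H. Iwaniec, Ann. of Math. (2) 148 (1998), 945–1040 [FriedlanderIwaniecAnnals1998], §5,
(5.2)–(5.6): "Since `n` is odd so is `z`. Multiplying `w` and `z` by a unit one can rotate `z` to a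
number satisfying (5.3) `z ≡ 1 (mod 2(1 + i))`. Such a number is called primary; it is determined
uniquely by its ideal. … By (5.2) we can express the bilinear form (4.20) as
(5.6) `B*(M, N) = Σ_{(w w̄, z z̄) = 1} α_w β_z 𝔷(Re w̄ z)` where `α_w = α(|w|²)` and
`β_z = β(|z|²)`. Here we assume that `z` runs over primary numbers so the multiplicity four does not
occur in (5.6)."

Everything here is PROVED; the file continues the §5 reduction of (4.23)
(`FriedlanderIwaniec1998_bilinear423`) begun in `FriedlanderIwaniecPrimesGaussianParam` ((5.2)).

## Contents

* `sum_sqPairs_eq_four_mul_sum_primary`: for odd `n`, a unit-invariant function summed over all `z`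
  with `|z|² = n` is four times its sum over the primary ones (one primary element per unit orbit;
  primary = the tree's `Literature.NumberTheory.QuadraticFields.GaussianPrimary.IsPrimary`, which is
  FI's (5.3) = (5.4)–(5.5));
* `fiRepCount_mul_eq_sum_primary`: `a_{mn} = Σ_{|w|² = m} Σ_{z primary, |z|² = n} 𝔷(Re w̄ z)` for
  coprime `m, n`, `n` odd;
* `fiGaussStar` (the form (5.6), grouped by norms) and `fiBilinearStar_eq_fiGaussStar`:
  `B*(M, N)` of (4.20) (`fiBilinearStar`, `FriedlanderIwaniecPrimesBilinearForm`) IS this Gaussian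
  form whenever `P > 2`.

## References

* J. Friedlander, H. Iwaniec, Ann. of Math. (2) 148 (1998), 945–1040, §5 (5.2)–(5.6).
  [FriedlanderIwaniecAnnals1998]

## Tree

`four_mul_fiRepCount_eq_sum`, `sqPairs`, `toGauss`, `ofGauss`, `fiZeta`, `card_sqPairs_one`,
`mul_star_eq_one_of_norm` (`…GaussianParam`); `IsPrimary`, `primary`, `primaryNormEq`,
`isPrimary_primary`, `norm_primary`, `exists_isUnit_primary_eq`, `primary_isUnit_mul`,
`primary_of_isPrimary`, `norm_emod_two` (`QuadraticFields.GaussianPrimary`); `fiBeta`,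
`fiBilinearStar` (`…BilinearForm`).
-/

noncomputable section

open Finset
open Literature.NumberTheory.QuadraticFields.GaussianPrimary

namespace Literature.NumberTheory.Sieve.FriedlanderIwaniecPrimes

open GaussianInt Zsqrtd

/-! ### Unit orbits and primary representatives -/

/-- The elements of norm `1` are the units (coordinates `sqPairs 1`); `toGauss` of them. [folklore] -/
theorem norm_toGauss_eq_one_iff {e : ℤ × ℤ} : (toGauss e).norm = 1 ↔ e ∈ sqPairs 1 := by
  rw [mem_sqPairs_iff_norm]; norm_cast

/-- An element of odd norm has `re + im` odd. [folklore] -/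
theorem parity_odd_of_norm_odd {z : GaussianInt} {n : ℕ} (hn : n % 2 = 1) (hz : z.norm = n) :
    (z.re + z.im) % 2 = 1 := by
  have h := norm_emod_two z
  rw [hz] at h
  have : ((n : ℤ) % 2) = 1 := by exact_mod_cast hn
  omega

/-- Multiplying by an element of norm `1` does not change the primary associate. [folklore] -/
theorem primary_mul_of_norm_eq_one {ε : GaussianInt} (hε : ε.norm = 1) (z : GaussianInt) :
    primary (ε * z) = primary z :=
  primary_isUnit_mul ((Zsqrtd.norm_eq_one_iff' (by norm_num) ε).mp hε) z

/-- **Unit orbits**: for odd `n`, summing a unit-invariant function over all `z` with `N(z) = n`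
is four times the sum over the primary ones ("Multiplying `w` and `z` by a unit one can rotate `z`
to a number satisfying (5.3) `z ≡ 1 (mod 2(1+i))` … it is determined uniquely by its ideal").
[cite: FriedlanderIwaniecAnnals1998, (5.3)] -/
theorem sum_sqPairs_eq_four_mul_sum_primary {M : Type*} [AddCommMonoid M] {n : ℕ} (hn : n % 2 = 1)
    (G : GaussianInt → M) (hG : ∀ ε z : GaussianInt, ε.norm = 1 → G (ε * z) = G z) :
    ∑ z ∈ sqPairs n, G (toGauss z) = 4 • ∑ x ∈ primaryNormEq n, G x := by
  -- fibre over the primary associate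
  have hmaps : ((sqPairs n : Finset (ℤ × ℤ)) : Set (ℤ × ℤ)).MapsTo
      (fun z => primary (toGauss z)) (primaryNormEq n : Set GaussianInt) := by
    intro z hz
    have hzn : (toGauss z).norm = n := mem_sqPairs_iff_norm.mp (mem_coe.mp hz)
    have hpar := parity_odd_of_norm_odd hn hzn
    refine mem_coe.mpr (mem_primaryNormEq.mpr ⟨?_, isPrimary_primary hpar⟩)
    rw [norm_primary hpar, hzn]
  rw [← sum_fiberwise_of_maps_to hmaps, ← sum_nsmul]
  refine sum_congr rfl fun x hx => ?_
  obtain ⟨hxn, hxp⟩ := mem_primaryNormEq.mp hx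
  have hx0 : x ≠ 0 := hxp.ne_zero
  -- the fibre is the unit orbit of `x`
  have hfib : ((sqPairs n).filter fun z => primary (toGauss z) = x) =
      (sqPairs 1).image fun e => ofGauss (toGauss e * x) := by
    ext z
    rw [mem_filter, mem_image]
    constructor
    · rintro ⟨hz, hzx⟩
      have hzn : (toGauss z).norm = n := mem_sqPairs_iff_norm.mp hz
      have hpar := parity_odd_of_norm_odd hn hzn
      obtain ⟨u, hu, hux⟩ := exists_isUnit_primary_eq hpar
      -- `x = u * z`, so `z = star u * x`
      have hu1 : u.norm = 1 := (Zsqrtd.norm_eq_one_iff' (by norm_num) u).mpr hu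
      refine ⟨ofGauss (star u), ?_, ?_⟩
      · rw [← norm_toGauss_eq_one_iff, toGauss_ofGauss, Zsqrtd.norm_conj, hu1]
      · rw [toGauss_ofGauss, ← hzx, hux, ← mul_assoc, mul_comm (star u) u,
          mul_star_eq_one_of_norm hu1, one_mul, ofGauss_toGauss]
    · rintro ⟨e, he, rfl⟩
      have hε : (toGauss e).norm = 1 := norm_toGauss_eq_one_iff.mpr he
      refine ⟨?_, ?_⟩
      · rw [mem_sqPairs_iff_norm, toGauss_ofGauss, Zsqrtd.norm_mul, hε, hxn, one_mul]
      · rw [toGauss_ofGauss, primary_mul_of_norm_eq_one hε, primary_of_isPrimary hxp]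
  rw [hfib, sum_image]
  · -- each unit contributes `G x`
    rw [sum_congr rfl (g := fun _ => G x), sum_const, card_sqPairs_one]
    intro e he
    simp only [toGauss_ofGauss]
    exact hG _ _ (norm_toGauss_eq_one_iff.mpr he)
  · intro e _ e' _ h
    have h' := congrArg toGauss h
    rw [toGauss_ofGauss, toGauss_ofGauss] at h'
    exact toGauss_injective (mul_right_cancel₀ hx0 h')

/-- Multiplication by an element of norm `1` permutes the representations of `k`. [folklore] -/
theorem sqPairs_image_mul_unit (k : ℕ) {ε : GaussianInt} (hε : ε.norm = 1) :
    (sqPairs k).image (fun uv => ofGauss (ε * toGauss uv)) = sqPairs k := by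
  have hε0 : ε ≠ 0 := by
    intro h; rw [h, Zsqrtd.norm_zero] at hε; exact zero_ne_one hε
  have hinj : Function.Injective (fun uv : ℤ × ℤ => ofGauss (ε * toGauss uv)) := by
    intro a b h
    have h' := congrArg toGauss h
    simp only [toGauss_ofGauss] at h'
    exact toGauss_injective (mul_left_cancel₀ hε0 h')
  apply eq_of_subset_of_card_le
  · intro w hw
    obtain ⟨uv, huv, rfl⟩ := mem_image.mp hw
    rw [mem_sqPairs_iff_norm, toGauss_ofGauss, Zsqrtd.norm_mul, hε, one_mul]
    exact mem_sqPairs_iff_norm.mp huv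
  · rw [card_image_of_injective _ hinj]

/-- `Σ_{|w|² = m} 𝔷(Re w̄ z)` is invariant under `z ↦ ε z`, `N(ε) = 1` (substitute `w ↦ ε w`). [folklore] -/
theorem sum_fiZeta_mul_unit (m : ℕ) {ε : GaussianInt} (hε : ε.norm = 1) (z : GaussianInt) :
    ∑ uv ∈ sqPairs m, fiZeta (star (toGauss uv) * (ε * z)).re =
      ∑ uv ∈ sqPairs m, fiZeta (star (toGauss uv) * z).re := by
  have hε0 : ε ≠ 0 := by
    intro h; rw [h, Zsqrtd.norm_zero] at hε; exact zero_ne_one hε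
  conv_lhs => rw [← sqPairs_image_mul_unit m hε]
  rw [sum_image]
  · refine sum_congr rfl fun uv _ => ?_
    simp only [toGauss_ofGauss, star_mul']
    congr 2
    calc star ε * star (toGauss uv) * (ε * z) = (ε * star ε) * (star (toGauss uv) * z) := by ring
      _ = star (toGauss uv) * z := by rw [mul_star_eq_one_of_norm hε, one_mul]
  · intro a _ b _ h
    have h' := congrArg toGauss h
    simp only [toGauss_ofGauss] at h'
    exact toGauss_injective (mul_left_cancel₀ hε0 h')

/-- **`a_{mn}` over primary `z`** ((5.2) with (5.3): "we assume that `z` runs over primary numbers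
so the multiplicity four does not occur in (5.6)"): for coprime `m, n` with `n` odd,
`a_{mn} = Σ_{|w|² = m} Σ_{z primary, |z|² = n} 𝔷(Re w̄ z)`.
[cite: FriedlanderIwaniecAnnals1998, (5.2)-(5.3) and (5.6)] -/
theorem fiRepCount_mul_eq_sum_primary {m n : ℕ} (hn : n % 2 = 1) (hmn : m.Coprime n) :
    fiRepCount (m * n) =
      ∑ uv ∈ sqPairs m, ∑ z ∈ primaryNormEq n, fiZeta (star (toGauss uv) * z).re := by
  have hn0 : 0 < n := by omega
  have h4 := four_mul_fiRepCount_eq_sum hn0 hmn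
  -- the coordinates form of the summand
  have e : ∀ uv rs : ℤ × ℤ, fiZeta (uv.1 * rs.1 + uv.2 * rs.2) =
      fiZeta (star (toGauss uv) * toGauss rs).re := by
    intro uv rs
    rw [← toGauss_gaussMulConj]; rfl
  simp_rw [e] at h4
  rw [sum_comm] at h4
  -- unit orbits on the `z`-side, for the unit-invariant `G(z) = Σ_w 𝔷(Re w̄ z)`
  rw [sum_sqPairs_eq_four_mul_sum_primary hn
    (fun z => ∑ uv ∈ sqPairs m, fiZeta (star (toGauss uv) * z).re)
    (fun ε z hε => sum_fiZeta_mul_unit m hε z), smul_eq_mul, sum_comm] at h4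
  omega

/-! ### `B*(M, N)` as a Gaussian bilinear form -/

/-- If `β(n) ≠ 0` then `n` is odd, provided `P > 2` ((4.21): every prime factor of `n` is `≥ P`).
[folklore] -/
theorem odd_of_fiBeta_ne_zero {p : ℝ → ℝ} {C P τ : ℝ} (hP : 2 < P) {n : ℕ} (hn : 0 < n)
    (h : fiBeta p C P τ n ≠ 0) : n % 2 = 1 := by
  by_contra hodd
  have h2 : 2 ∣ n := Nat.dvd_of_mod_eq_zero (by omega)
  have hmem : 2 ∈ n.primeFactors := Nat.mem_primeFactors.mpr ⟨Nat.prime_two, h2, hn.ne'⟩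
  unfold fiBeta at h
  split_ifs at h with hc
  · have := hc.1 2 hmem
    norm_num at this
    linarith
  · exact h rfl

/-- FI (5.6) for `B*(M, N)`: the form (4.20) written over Gaussian integers,
`B*(M, N) = Σ_{(w w̄, z z̄) = 1} α_w β_z 𝔷(Re w̄ z)` with `α_w = α(|w|²)`, `β_z = β(|z|²)` and `z`
primary — here grouped by the norms `m = |w|²`, `n = |z|²` (the inner double sum replacing `a_{mn}`
of `fiBilinearStar`). [cite: FriedlanderIwaniecAnnals1998, (5.6)] -/
def fiGaussStar (α : ℕ → ℂ) (p : ℝ → ℝ) (M N' θ C P τ : ℝ) : ℂ :=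
  ∑ m ∈ Ioc ⌊M⌋₊ ⌊2 * M⌋₊,
    ∑ n ∈ (Ioc ⌊N'⌋₊ ⌊(1 + θ) * N'⌋₊).filter (fun n : ℕ => n.Coprime m),
      α m * ((fiBeta p C P τ n : ℝ) : ℂ) *
        ((∑ uv ∈ sqPairs m, ∑ z ∈ primaryNormEq n, fiZeta (star (toGauss uv) * z).re : ℕ) : ℂ)

/-- `fiGaussStar` unfolded. [cite: FriedlanderIwaniecAnnals1998, (5.6)] -/
theorem fiGaussStar_def (α : ℕ → ℂ) (p : ℝ → ℝ) (M N' θ C P τ : ℝ) :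
    fiGaussStar α p M N' θ C P τ = ∑ m ∈ Ioc ⌊M⌋₊ ⌊2 * M⌋₊,
      ∑ n ∈ (Ioc ⌊N'⌋₊ ⌊(1 + θ) * N'⌋₊).filter (fun n : ℕ => n.Coprime m),
        α m * ((fiBeta p C P τ n : ℝ) : ℂ) *
          ((∑ uv ∈ sqPairs m, ∑ z ∈ primaryNormEq n, fiZeta (star (toGauss uv) * z).re : ℕ) : ℂ) :=
  rfl

/-- **`B*(M, N)` is the Gaussian form (5.6)** (for `P > 2`, so that `β` lives on odd `n`):
`fiBilinearStar = fiGaussStar`, by (5.2)–(5.3) (`fiRepCount_mul_eq_sum_primary`).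
[cite: FriedlanderIwaniecAnnals1998, (5.2)-(5.6)] -/
theorem fiBilinearStar_eq_fiGaussStar (α : ℕ → ℂ) (p : ℝ → ℝ) (M N' θ C τ : ℝ) {P : ℝ}
    (hP : 2 < P) : fiBilinearStar α p M N' θ C P τ = fiGaussStar α p M N' θ C P τ := by
  unfold fiBilinearStar fiGaussStar
  refine sum_congr rfl fun m _ => sum_congr rfl fun n hn => ?_
  obtain ⟨hn1, hcop⟩ := mem_filter.mp hn
  have hn0 : 0 < n := by rw [mem_Ioc] at hn1; omega
  by_cases hb : fiBeta p C P τ n = 0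
  · simp [hb]
  · have hodd := odd_of_fiBeta_ne_zero hP hn0 hb
    rw [fiRepCount_mul_eq_sum_primary hodd hcop.symm]
    push_cast
    ring

end Literature.NumberTheory.Sieve.FriedlanderIwaniecPrimes
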